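import Summits.SmoothPoincare4.SmoothPoincare4.Theorems.SullivanDualWitnessChargeDeformationFamilyOfCore
import Literature.Geometry.Symplectic.SphereCRBootstrap

/-!
# Birth stub A of crux `WitnessCharge` (line `Sketch`): the deformation family of `J`-spheres

`stub_deformationFamily` (registered stub of item stmt-SmoothPoincare4-7824, identical with birth
stub A of crux 16778): an embedded `J`-holomorphic sphere `u₀ ∪ v₀` (two affine charts,
`v₀ z = u₀ z⁻¹`) in an almost complex 4-manifold, cut out transversally by a submersion `πN` on a
neighbourhood `N` (so its normal bundle is trivial), is the member `a = 0` of a COMPLEX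
ONE-PARAMETER FAMILY `U a ∪ V a` (`‖a‖ < ε`) of `J`-holomorphic spheres, jointly `C^∞` in
`(a, z)`, with EFFECTIVE first variation (`∂ₐ (πN ∘ U · z) ≠ 0` somewhere). This is the
Hofer–Lizan–Sikorav local foliation theorem (Wendl 2018, Thm. 2.46) and is obtained here by
composing

* the CHART-LEVEL ANALYTIC CORE `Literature.Geometry.Symplectic.SphereCR.SphereACData.coreFor`
  (`SphereCRBootstrap.lean`): for the chart data `𝒥 : SphereACData` of `J` along the sphere, the
  implicit function theorem in Hölder section spaces over `S²` — linearisation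
  `[[2∂̄_T, M], [0, 2∂̄ + A]]` bordered by the tangential three-point slice and the normal point
  evaluation, an isomorphism by Liouville/Dolbeault on `O(2)` and automatic transversality on
  `O(0)` — produces the family, and elliptic bootstrapping at every Hölder level makes it jointly
  smooth (`CoreFor 𝒥`);
* the MANIFOLD-SIDE PACKAGING `helper_deformationFamily_of_core`
  (`SullivanDualWitnessChargeDeformationFamilyOfCore.lean`): product neighbourhood
  `ι : ℂℙ¹ × ℂ ↪ X` of the sphere, chart data, gluing of the two chart families, transfer of
  `J`-holomorphicity, joint smoothness and effectiveness at `z = 0`.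

## References

* C. Wendl, *Holomorphic Curves in Low Dimensions*, LNM 2216 (2018), Thm. 2.46, Prop. 2.53.
* H. Hofer, V. Lizan, J.-C. Sikorav, *On genericity for holomorphic curves in four-dimensional
  almost-complex manifolds*, J. Geom. Anal. 7 (1997) 149–159.
-/

noncomputable section

set_option linter.dupNamespace false

open scoped Manifold ContDiff Topology
open Set Filter Function Literature.Geometry.Symplectic Literature.Topology.FourManifolds

namespace Summit.SmoothPoincare4.SmoothPoincare4.Theorems.WitnessCharge.PencilIncompleteness

/-- **The deformation family of an embedded `J`-sphere with trivial normal bundle**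
(Hofer–Lizan–Sikorav / Wendl 2018, Thm. 2.46): registered stub `stub_deformationFamily` of crux
`WitnessCharge`, line `Sketch` — the chart-level analytic core `SphereACData.coreFor` composed with
the manifold-side packaging `helper_deformationFamily_of_core`. -/
theorem stub_deformationFamily : ∀ (X : Type) [TopologicalSpace X] [T2Space X] [SecondCountableTopology X] [ChartedSpace (EuclideanSpace ℝ (Fin 4)) X] [IsManifold (𝓡 4) ∞ X] (JX : AlmostComplexStructure (𝓡 4) ∞ X) (u₀ v₀ : ℂ → X) (N : Set X) (πN : X → ℂ), ContMDiff 𝓘(ℝ, ℂ) (𝓡 4) ∞ u₀ → ContMDiff 𝓘(ℝ, ℂ) (𝓡 4) ∞ v₀ → (∀ z : ℂ, z ≠ 0 → v₀ z = u₀ z⁻¹) → IsJHolomorphic (𝓡 4) (fun y => JX y) u₀ → IsJHolomorphic (𝓡 4) (fun y => JX y) v₀ → Injective u₀ → (∀ z, Injective (mfderiv 𝓘(ℝ, ℂ) (𝓡 4) u₀ z)) → Injective (mfderiv 𝓘(ℝ, ℂ) (𝓡 4) v₀ 0) → v₀ 0 ∉ range u₀ → IsOpen N → range u₀ ∪ {v₀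 0} ⊆ N → ContMDiffOn (𝓡 4) 𝓘(ℝ, ℂ) ∞ πN N → (∀ y ∈ N, Surjective (mfderiv (𝓡 4) 𝓘(ℝ, ℂ) πN y)) → {y | y ∈ N ∧ πN y = 0} = range u₀ ∪ {v₀ 0} → ∃ (ε : ℝ) (U V : ℂ → ℂ → X), 0 < ε ∧ (∀ z, U 0 z = u₀ z) ∧ (∀ w, V 0 w = v₀ w) ∧ (∀ a : ℂ, ‖a‖ < ε → (∀ z : ℂ, z ≠ 0 → V a z = U a z⁻¹) ∧ IsJHolomorphic (𝓡 4) (fun y => JX y) (U a) ∧ IsJHolomorphic (𝓡 4) (fun y => JX y) (V a)) ∧ ContMDiffOn 𝓘(ℝ, ℂ × ℂ) (𝓡 4) ∞ (fun q : ℂ × ℂ => U q.1 q.2) (Metric.ball 0 ε ×ˢ univ) ∧ ContMDiffOn 𝓘(ℝ, ℂ × ℂ) (𝓡 4) ∞ (fun q : ℂ × ℂ => V q.1 q.2) (Metric.ball 0 ε ×ˢ univ) ∧ (∀ c : ℂ, c ≠ 0 → (∃ z, (fderiv ℝ (fun a : ℂ => πN (U a z)) 0) c ≠ 0) ∨ (∃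 w, (fderiv ℝ (fun a : ℂ => πN (V a w)) 0) c ≠ 0)) :=
  helper_deformationFamily_of_core fun 𝒥 => 𝒥.coreFor

end Summit.SmoothPoincare4.SmoothPoincare4.Theorems.WitnessCharge.PencilIncompleteness

end
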